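import Summits.QuantumFields.BalabanUV.Beta.SpineRootedScN
import Summits.QuantumFields.BalabanUV.Beta.SpineRootedStep

/-!
# The ROOTED first-order spine in the NATIVE placement — part C: `e3NAtOf ρ`, `SstepNAt ρ`, the undressed family `JsBal0NAtOf`
# (twin of `SpineRootedStep` WITHOUT `mfNeg`; β sub-cell, row BETA-an2, gen 14; NOTE X-an2-45 / proposed (R45-1); beside the old spine)

HONEST FRAMING (cell charter, verbatim): «discharging BetaPertH makes Balaban's UV stability UNCONDITIONAL — a real
constructive-QFT result; it is NOT the continuum limit and NOT the Clay problem.»  DERIVED cell leaf (pub-balaban β sub-cell, lane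
an2 gen 14); no statement of Bałaban's papers is typed here, no `[cite:]` tag, no `Prop` fact; it instantiates no binder of the
β-function wall by itself.  NOT `BetaPertH`; NOT continuum; NOT Clay.

## What is here (decl-by-decl twin of `SpineRootedStep` §C1–§C4 over the native-placement composite stencil `ScNAt`)

`e3NAtOf ρ j` (the value-function third jet through BCJ's one-shot vertex of `ScNAt ρ (j−1)`), `locStencil_e3NAtOf`, `SstepNAt ρ j` (the
step stencil with an1's `vhSAt ρ` in its NATIVE placement — no `mfNeg` — and the placement-free `e3NAtOf`/Λ-summands), `locStencil_SstepNAt`,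
the datum `jsStepNAtOf`, the UNDRESSED family **`JsBal0NAtOf`** (member `0` = `SpineRootedS0N.jsBal0NAtOf`, member `j+1` = `jsStepNAtOf (j+1)`)
with its `rfl` lemmas, and the (St♭)/(Wt) sockets `e3NAtOf_translate`, `SstepNAt_translate`, `JsBal0NAtOf_S_translate`, `JsBal0NAtOf_W_translate`.
The Π_root-dressed family of `SpineRootedStep` (`JsBalAtOf`) has no twin (route dead in mechanism, X-an2-42); the Π_bm-dressed twin and the
coarse wiring follow in `SpineRootedBmN`.  Proofs: those of `SpineRootedStep` verbatim with `locStencil_vhSAt` in place of `locStencil_mfNeg ∘`.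

Provenance: b2b-balaban β sub-cell, unit beta-an2 gen 14, 2026-08-20 (v1); over `SpineRootedScN`/`SpineRootedS0N`/`SpineRootedStep` (an2),
`Beta.BalabanStepJetsSucc` (an2), `Beta.AveragingHessianKernelsRooted` (an1) BY NAME; no existing file touched.
-/

open Finset
open scoped BigOperators
open Literature.MathematicalPhysics.QuantumFieldTheory
open Literature.MathematicalPhysics.QuantumFieldTheory.Balaban1983to89
open Literature.MathematicalPhysics.QuantumFieldTheory.Balaban1983to89.Beta
open LatticeForm (quo proj_add_zsmul)
open BlochFibreUniqueness (quo_add_zsmul)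
open B12Sec2to5 (l1 l1_nonneg)
open ExpKernelCalculus (Decays BiLoc VertexFamily VertexFamily₂ shiftK Zl Zl_nonneg l1_sub_triangle l1_sub_symm)
open OneStepResolventKernel (Fib LocStencil JetData KInv decays_KInv shiftK_KInv biLoc_mono biLoc_finset_sum)
open AffineAveraging (Form1 Form2 box toSite)
open StepJetData (wilsonA wBound locStencil_wilsonA wilsonA_translate locStencil_add locStencil_smul biLoc_smul biLoc_weaken l1_add_le)
open AveragingHessianKernels (ell)
open AveragingHessianKernelsRooted (vhSAt locStencil_vhSAt vhSAt_translate hessFFAt biLoc_hessFFAt hessFFAt_translate)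
open InterLevelTransport (SLam locStencil_SLam SLam_translate cwsum avgLift biLoc_avgLift avgLift_shiftK)
open BalabanStepJets (lamCoeffOf abs_lamCoeffOf_le lamCoeffOf_translate locStencil_mono vertexFamily₂_mono)
open ExpKernelCalculus (MKer comp comp_shiftK)
open OneStepResolventKernel (decays_mono vertexOf vertexFamily_vertexOf')
open OneStepKernelFamily (KInvStep decays_KInvStep shiftK_KInvStep TstepOf TbalOf)
open BalabanStepJetsSucc (mmRead E2 decays_E2 one_le_pow_Lc lamCoeffK abs_lamCoeffK_le wE wVH wΛ vertexOf_translate_block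
  comp_sandwich_shiftK mmRead_shiftK_smul shiftK_E2 lamCoeffK_translate biLoc_comp_right biLoc_mmRead decays_mmRead)

noncomputable section

namespace Summit.QuantumFields.BalabanUV.Beta.SpineRooted

variable {d : ℕ}

/-! ## §C1♮ The rooted value-function third jet over the native composite stencil -/

section ValueJets

variable (d) (Lc : ℕ) [NeZero Lc]

/-- [folklore] **THE ROOTED VALUE-FUNCTION THIRD JET, NATIVE PLACEMENT** (twin of `e3AtOf` over `ScNAt`):
`e3NAtOf ρ j κ′ u′ := −mmRead (Lc^j) (KInv ∘ vertexOf (ScNAt ρ (j−1)) κ′ u′ ∘ KInv)`. -/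
def e3NAtOf (ρ : Fin (d + 1) → ℤ) (cE cVH cΛ : ℝ) (j : ℕ) :
    Fin (d + 1) → (Fin (d + 1) → ℤ) → ExpKernelCalculus.MKer (d + 1) (Fib d) :=
  fun κ' u' x' z' a b =>
    -(mmRead (Lc ^ j)
      (comp (comp (KInv (N := Lc ^ j) (d := d)) (vertexOf (N := Lc ^ j) (ScNAt d Lc ρ cE cVH cΛ (j - 1)) κ' u'))
        (KInv (N := Lc ^ j) (d := d))) x' z' a b)

variable {d Lc}

/-- [folklore] **`e3NAtOf (toSite r) j` IS A LOCAL STENCIL FAMILY** on the step-`j` lattice (proof of `locStencil_e3AtOf` over `locStencil_ScNAt`). -/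
theorem locStencil_e3NAtOf (hLc : 1 ≤ Lc) {r : Fin (d + 1) → ℕ} (hr : r ∈ box (d + 1) Lc) (cE cVH cΛ : ℝ) (j : ℕ) :
    ∃ Cs δ : ℝ, 0 < δ ∧ LocStencil (e3NAtOf d Lc (toSite r) cE cVH cΛ j) Cs δ := by
  obtain ⟨δK, CK, hδK, hCK, hK⟩ := decays_KInv (N := Lc ^ j) (d := d)
  obtain ⟨Cs, δs, hδs, hS⟩ := locStencil_ScNAt (d := d) (Lc := Lc) hLc hr cE cVH cΛ (j - 1)
  obtain ⟨Cv, δv, hδv, hV⟩ := vertexFamily_vertexOf' (N := Lc ^ j) hS hδs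
  set m : ℝ := min δK δv with hm
  have hm0 : 0 < m := lt_min hδK hδv
  have hCv : 0 ≤ Cv := (hV 0 0).nonneg (Sum.inl 0)
  have hKm : Decays (KInv (N := Lc ^ j) (d := d)) CK m := decays_mono hK hCK le_rfl (min_le_left _ _)
  have hKm2 : Decays (KInv (N := Lc ^ j) (d := d)) CK (m / 2) := decays_mono hK hCK le_rfl (by linarith [min_le_left δK δv])
  refine ⟨(Fintype.card (Fib d) : ℝ) * (((Fintype.card (Fib d) : ℝ) * (CK * Cv) * Zl (d + 1) (m - m / 2)) * CK) *
      Zl (d + 1) (m / 2 - m / 4), m / 4, by positivity, fun κ' u' => ?_⟩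
  have hVm : BiLoc (vertexOf (N := Lc ^ j) (ScNAt d Lc (toSite r) cE cVH cΛ (j - 1)) κ' u') ((((Lc ^ j : ℕ) : ℤ)) • u')
      ((((Lc ^ j : ℕ) : ℤ)) • u') Cv m := biLoc_mono (hV κ' u') hCv (min_le_right _ _)
  have h1 := ExpKernelCalculus.biLoc_comp_decays hKm hVm (show 0 ≤ m / 2 by positivity) (by linarith)
  have h2 := biLoc_comp_right h1 hKm2 (show 0 ≤ m / 4 by positivity) (by linarith)
  intro x' z' a b
  rw [show e3NAtOf d Lc (toSite r) cE cVH cΛ j κ' u' x' z' a b = -(mmRead (Lc ^ j)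
      (comp (comp (KInv (N := Lc ^ j) (d := d)) (vertexOf (N := Lc ^ j) (ScNAt d Lc (toSite r) cE cVH cΛ (j - 1)) κ' u'))
        (KInv (N := Lc ^ j) (d := d))) x' z' a b) from rfl, abs_neg]
  exact biLoc_mmRead (one_le_pow_Lc j) h2 (by positivity) x' z' a b

end ValueJets

/-! ## §C2♮ The rooted step stencils `SstepNAt ρ j` (`j ≥ 1`) in the native placement -/

section Step

variable (d) (Lc : ℕ) [NeZero Lc]

/-- [folklore] **BAŁABAN'S ROOTED STEP-`j` FIRST-ORDER STENCIL FAMILY, NATIVE PLACEMENT** (twin of `SstepAt` WITHOUT `mfNeg`):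
`SstepNAt ρ j κ′ u′ := (cE·wE j) • e3NAtOf ρ j κ′ u′ + (cVH·wVH j) • vhSAt ρ d Lc κ′ u′ + (cΛ·wΛ j) • SLam Lc (lamCoeffK …) (hessFFAt ρ Lc) κ′ u′`. -/
def SstepNAt (ρ : Fin (d + 1) → ℤ) (cE cVH cΛ : ℝ) (j : ℕ) :
    Fin (d + 1) → (Fin (d + 1) → ℤ) → ExpKernelCalculus.MKer (d + 1) (Fib d) := fun κ' u' =>
  (cE * wE d Lc j) • e3NAtOf d Lc ρ cE cVH cΛ j κ' u' + (cVH * wVH d Lc j) • vhSAt ρ d Lc rfl κ' u' +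
    (cΛ * wΛ d Lc j) • SLam Lc (lamCoeffK (KInvStep (d := d) Lc j) (E2 d Lc j) Lc) (fun μ y => hessFFAt ρ Lc μ y) κ' u'

variable {d Lc}

/-- [folklore] **`SstepNAt (toSite r) j` IS A LOCAL STENCIL FAMILY** (proof of `locStencil_SstepAt` with `locStencil_vhSAt`). -/
theorem locStencil_SstepNAt (hLc : 1 ≤ Lc) {r : Fin (d + 1) → ℕ} (hr : r ∈ box (d + 1) Lc) (cE cVH cΛ : ℝ) (j : ℕ) :
    ∃ Cs δ : ℝ, 0 < δ ∧ LocStencil (SstepNAt d Lc (toSite r) cE cVH cΛ j) Cs δ := by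
  obtain ⟨C₁, δ₁, hδ₁, h1⟩ := locStencil_e3NAtOf (d := d) (Lc := Lc) hLc hr cE cVH cΛ j
  obtain ⟨δA, CA, hδA, hCA, hA⟩ := decays_KInvStep (Lc := Lc) (d := d) j
  obtain ⟨δE, CE, hδE, hCE, hE⟩ := decays_E2 (d := d) (Lc := Lc) j
  set n : ℝ := min δA δE with hn
  have hn0 : 0 < n := lt_min hδA hδE
  have hA' : Decays (KInvStep (d := d) Lc j) CA n := decays_mono hA hCA le_rfl (min_le_left _ _)
  have hE' : Decays (E2 d Lc j) CE n := decays_mono hE hCE le_rfl (min_le_right _ _)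
  have hc := abs_lamCoeffK_le hA' hE' hn0 Lc
  have hn2 : (0 : ℝ) ≤ n / 2 := by positivity
  have hQ : VertexFamily (fun μ y => hessFFAt (toSite r) Lc μ y) Lc
      (2 * (ell (d + 1) Lc : ℝ) ^ 2 * Real.exp (4 * ((d : ℝ) + 1) * Lc * (n / 2))) (n / 2) :=
    fun μ y => biLoc_hessFFAt hLc μ y hr hn2
  have h3 := locStencil_SLam (N := Lc) hc hQ (by positivity)
    (mul_nonneg (mul_nonneg (Nat.cast_nonneg _) (mul_nonneg hCA hCE)) (Zl_nonneg (by linarith)))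
  set r' : ℝ := min δ₁ (n / 2 / 2) with hr'
  have hr0 : 0 < r' := lt_min hδ₁ (by positivity)
  have hC₁ : 0 ≤ C₁ := (h1 0 0).nonneg (Sum.inl 0)
  have h1r : LocStencil (e3NAtOf d Lc (toSite r) cE cVH cΛ j) C₁ r' := locStencil_mono h1 hC₁ (min_le_left _ _)
  have h2r : LocStencil (vhSAt (toSite r) d Lc rfl)
      (3 * (ell (d + 1) Lc : ℝ) ^ 2 * Real.exp (4 * ((d : ℝ) + 1) * Lc * r')) r' := locStencil_vhSAt hLc hr hr0.le
  have h3r := locStencil_mono h3 ((h3 0 0).nonneg (Sum.inl 0)) (min_le_right δ₁ (n / 2 / 2))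
  exact ⟨_, r', hr0, locStencil_add (locStencil_add (locStencil_smul (cE * wE d Lc j) h1r)
    (locStencil_smul (cVH * wVH d Lc j) h2r)) (locStencil_smul (cΛ * wΛ d Lc j) h3r)⟩

end Step

/-! ## §C3♮ The rooted UNDRESSED family `JsBal⁰♮_ρ` in the native placement -/

section Family

variable {Lc : ℕ} [NeZero Lc]

/-- [folklore] **THE ROOTED STEP-`j` JET DATUM, NATIVE PLACEMENT** `(SstepNAt (toSite r) j, W j)`. -/
def jsStepNAtOf (hLc : 1 ≤ Lc) {r : Fin (d + 1) → ℕ} (hr : r ∈ box (d + 1) Lc) (cE cVH cΛ : ℝ)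
    (W : ℕ → Fin (d + 1) → (Fin (d + 1) → ℤ) → Fin (d + 1) → (Fin (d + 1) → ℤ) → ExpKernelCalculus.MKer (d + 1) (Fib d))
    (Cw δw : ℕ → ℝ) (hδw : ∀ j, 0 < δw j) (hW : ∀ j, VertexFamily₂ (W j) Lc (Cw j) (δw j)) (j : ℕ) : JetData d Lc :=
  have hS := locStencil_SstepNAt (d := d) (Lc := Lc) hLc hr cE cVH cΛ j
  have hδS : 0 < hS.choose_spec.choose := hS.choose_spec.choose_spec.1
  have hloc : LocStencil (SstepNAt d Lc (toSite r) cE cVH cΛ j) hS.choose hS.choose_spec.choose := hS.choose_spec.choose_spec.2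
  { S := SstepNAt d Lc (toSite r) cE cVH cΛ j
    W := W j
    Cs := hS.choose
    Cw := Cw j
    δ := min hS.choose_spec.choose (δw j)
    δ_pos := lt_min hδS (hδw j)
    loc := locStencil_mono hloc ((hloc 0 0).nonneg (Sum.inl 0)) (min_le_left _ _)
    loc₂ := vertexFamily₂_mono (hW j) ((hW j 0 0 0 0).nonneg (Sum.inl 0)) (min_le_right _ _) }

variable (hLc : 1 ≤ Lc) {r : Fin (d + 1) → ℕ} (hr : r ∈ box (d + 1) Lc) (cE cVH cΛ : ℝ)
    (W : ℕ → Fin (d + 1) → (Fin (d + 1) → ℤ) → Fin (d + 1) → (Fin (d + 1) → ℤ) → ExpKernelCalculus.MKer (d + 1) (Fib d))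
    (Cw δw : ℕ → ℝ) (hδw : ∀ j, 0 < δw j) (hW : ∀ j, VertexFamily₂ (W j) Lc (Cw j) (δw j))

/-- [folklore] The first-order table of the native step member `j`. -/
@[simp] theorem jsStepNAtOf_S (j : ℕ) : (jsStepNAtOf hLc hr cE cVH cΛ W Cw δw hδw hW j).S = SstepNAt d Lc (toSite r) cE cVH cΛ j := rfl

/-- [folklore] The second-order table of the native step member `j` is the supplied `W j`. -/
@[simp] theorem jsStepNAtOf_W (j : ℕ) : (jsStepNAtOf hLc hr cE cVH cΛ W Cw δw hδw hW j).W = W j := rfl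

/-- [folklore] **THE ROOTED UNDRESSED FAMILY, NATIVE PLACEMENT `JsBal⁰♮_ρ`**: member `0` is `jsBal0NAtOf`, member `j+1` is
`jsStepNAtOf … (j+1)`; second-order tables `W j` abstract (their placement is the consumer's: an1-g22 (R45-2)). -/
def JsBal0NAtOf : ℕ → JetData d Lc
  | 0 => jsBal0NAtOf hLc hr cE cVH cΛ (W 0) (Cw 0) (δw 0) (hδw 0) (hW 0)
  | j + 1 => jsStepNAtOf hLc hr cE cVH cΛ W Cw δw hδw hW (j + 1)

/-- [folklore] Member `0` (closure lemma of the `match`). -/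
theorem JsBal0NAtOf_zero :
    JsBal0NAtOf hLc hr cE cVH cΛ W Cw δw hδw hW 0 = jsBal0NAtOf hLc hr cE cVH cΛ (W 0) (Cw 0) (δw 0) (hδw 0) (hW 0) := rfl

/-- [folklore] Member `j+1` (closure lemma of the `match`). -/
theorem JsBal0NAtOf_succ (j : ℕ) :
    JsBal0NAtOf hLc hr cE cVH cΛ W Cw δw hδw hW (j + 1) = jsStepNAtOf hLc hr cE cVH cΛ W Cw δw hδw hW (j + 1) := rfl

/-- [folklore] The first-order table of member `0` is `S0NAt … (toSite r) …`. -/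
@[simp] theorem JsBal0NAtOf_S_zero : (JsBal0NAtOf hLc hr cE cVH cΛ W Cw δw hδw hW 0).S = S0NAt d Lc (toSite r) cE cVH cΛ := rfl

/-- [folklore] The first-order table of member `j+1` is `SstepNAt … (toSite r) … (j+1)`. -/
@[simp] theorem JsBal0NAtOf_S_succ (j : ℕ) :
    (JsBal0NAtOf hLc hr cE cVH cΛ W Cw δw hδw hW (j + 1)).S = SstepNAt d Lc (toSite r) cE cVH cΛ (j + 1) := rfl

/-- [folklore] The second-order table of every member is the supplied `W j`. -/
@[simp] theorem JsBal0NAtOf_W : ∀ j : ℕ, (JsBal0NAtOf hLc hr cE cVH cΛ W Cw δw hδw hW j).W = W j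
  | 0 => rfl
  | _ + 1 => rfl

end Family

/-! ## §C4♮ The block-translation sockets (St♭)/(Wt) -/

section Covariance

variable {Lc : ℕ} [NeZero Lc]

/-- [folklore] **THE NATIVE ROOTED THIRD JET IS TRANSLATION COVARIANT ON THE STEP LATTICE** (members `j+1`; from `ScNAt_translate`). -/
theorem e3NAtOf_translate (ρ : Fin (d + 1) → ℤ) (hLc : 1 ≤ Lc) (cE cVH cΛ : ℝ) (j : ℕ) (κ' : Fin (d + 1))
    (u' t' : Fin (d + 1) → ℤ) :
    e3NAtOf d Lc ρ cE cVH cΛ (j + 1) κ' (u' + t') = shiftK (-t') (e3NAtOf d Lc ρ cE cVH cΛ (j + 1) κ' u') := by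
  have hS : ∀ (κ : Fin (d + 1)) (u t : Fin (d + 1) → ℤ),
      ScNAt d Lc ρ cE cVH cΛ (j + 1 - 1) κ (u + (((Lc ^ (j + 1) : ℕ) : ℤ)) • t)
        = shiftK (-((((Lc ^ (j + 1) : ℕ) : ℤ)) • t)) (ScNAt d Lc ρ cE cVH cΛ (j + 1 - 1) κ u) := by
    rw [Nat.add_sub_cancel]
    exact ScNAt_translate ρ hLc cE cVH cΛ j
  have hV := vertexOf_translate_block (N := Lc ^ (j + 1)) hS κ' u' t'
  have hK := shiftK_KInv (N := Lc ^ (j + 1)) (d := d) t'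
  funext x' z' a b
  simp only [e3NAtOf, shiftK]
  rw [hV, comp_sandwich_shiftK hK, mmRead_shiftK_smul]
  rfl

/-- [folklore] **(St♭) FOR THE NATIVE STEP STENCILS** `SstepNAt ρ (j+1)` (block translations `u ↦ u + Lc•t`). -/
theorem SstepNAt_translate (ρ : Fin (d + 1) → ℤ) (hLc : 1 ≤ Lc) (cE cVH cΛ : ℝ) (j : ℕ) (κ' : Fin (d + 1))
    (u t : Fin (d + 1) → ℤ) :
    SstepNAt d Lc ρ cE cVH cΛ (j + 1) κ' (u + (Lc : ℤ) • t) = shiftK (-((Lc : ℤ) • t)) (SstepNAt d Lc ρ cE cVH cΛ (j + 1) κ' u) := by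
  have h1 := e3NAtOf_translate (d := d) ρ hLc cE cVH cΛ j κ' u ((Lc : ℤ) • t)
  have h2 := vhSAt_translate (d := d) ρ hLc κ' u t
  have h3 := SLam_translate (N := Lc) (c := lamCoeffK (KInvStep (d := d) Lc (j + 1)) (E2 d Lc (j + 1)) Lc)
    (Q2 := fun μ y => hessFFAt ρ Lc μ y)
    (fun μ y κ'' u' t' => lamCoeffK_translate (fun s => shiftK_KInvStep (d := d) (Lc := Lc) (j + 1) s)
      (fun s => shiftK_E2 (d := d) (Lc := Lc) (j + 1) _) μ y κ'' u' t')
    (fun μ y t' => hessFFAt_translate ρ μ y t') κ' u t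
  funext x z a b
  simp only [SstepNAt, Pi.add_apply, Pi.smul_apply, smul_eq_mul, shiftK]
  rw [h1, h2, h3]
  rfl

variable (hLc : 1 ≤ Lc) {r : Fin (d + 1) → ℕ} (hr : r ∈ box (d + 1) Lc) (cE cVH cΛ : ℝ)
    (W : ℕ → Fin (d + 1) → (Fin (d + 1) → ℤ) → Fin (d + 1) → (Fin (d + 1) → ℤ) → ExpKernelCalculus.MKer (d + 1) (Fib d))
    (Cw δw : ℕ → ℝ) (hδw : ∀ j, 0 < δw j) (hW : ∀ j, VertexFamily₂ (W j) Lc (Cw j) (δw j))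

/-- [folklore] **(St♭) FOR `JsBal⁰♮_ρ`**, every member. -/
theorem JsBal0NAtOf_S_translate : ∀ (j : ℕ) (κ' : Fin (d + 1)) (u t : Fin (d + 1) → ℤ),
    (JsBal0NAtOf hLc hr cE cVH cΛ W Cw δw hδw hW j).S κ' (u + (Lc : ℤ) • t)
      = shiftK (-((Lc : ℤ) • t)) ((JsBal0NAtOf hLc hr cE cVH cΛ W Cw δw hδw hW j).S κ' u)
  | 0, κ', u, t => by rw [JsBal0NAtOf_S_zero]; exact S0NAt_translate (toSite r) hLc cE cVH cΛ κ' u t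
  | j + 1, κ', u, t => by rw [JsBal0NAtOf_S_succ]; exact SstepNAt_translate (toSite r) hLc cE cVH cΛ j κ' u t

/-- [folklore] **(Wt) FOR `JsBal⁰♮_ρ`** from that of the tables. -/
theorem JsBal0NAtOf_W_translate
    (hWt : ∀ (j : ℕ) (μ : Fin (d + 1)) (y : Fin (d + 1) → ℤ) (ν : Fin (d + 1)) (y' t : Fin (d + 1) → ℤ),
      W j μ (y + t) ν (y' + t) = shiftK (-((Lc : ℤ) • t)) (W j μ y ν y'))
    (j : ℕ) (μ : Fin (d + 1)) (y : Fin (d + 1) → ℤ) (ν : Fin (d + 1)) (y' t : Fin (d + 1) → ℤ) :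
    (JsBal0NAtOf hLc hr cE cVH cΛ W Cw δw hδw hW j).W μ (y + t) ν (y' + t)
      = shiftK (-((Lc : ℤ) • t)) ((JsBal0NAtOf hLc hr cE cVH cΛ W Cw δw hδw hW j).W μ y ν y') := by
  rw [JsBal0NAtOf_W]
  exact hWt j μ y ν y' t

end Covariance

end Summit.QuantumFields.BalabanUV.Beta.SpineRooted

end
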